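import Literature.Topology.FourManifolds.SliceGenus
import Mathlib.Geometry.Manifold.Instances.Sphere
import Mathlib.Geometry.Manifold.Diffeomorph
import Mathlib.Geometry.Manifold.LocalDiffeomorph
import Mathlib.Geometry.Manifold.MFDeriv.Basic
import HarnessLib

/-!
# The Seifert genus is an isotopy invariant: proof of a named fact of `SliceGenus.lean`

Sibling proof file of `SliceGenus.lean` (D-0014: named facts `def X : Prop` are discharged as
`theorem X_holds : X`). It discharges

* `Literature.Knot.IsIsotopic.genus_eq_holds : IsIsotopic.genus_eq` — isotopic knots
  (`Literature.Topology.FourManifolds.SphereEmbedding.IsIsotopic`, i.e. ambient isotopic in `𝕊 3`) have the same Seifert genus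
  `Literature.Topology.FourManifolds.Knot.genus` (the least genus of a Seifert surface, `Literature.Topology.FourManifolds.Knot.HasSeifertSurfaceOfGenus`),

via the transport lemma

* `Literature.Topology.FourManifolds.Knot.HasSeifertSurfaceOfGenus.of_diffeomorph` — a diffeomorphism `Φ` of `𝕊 3` with
  `Φ ∘ K = K'` carries Seifert surfaces of genus `g` of `K` to Seifert surfaces of genus `g`
  of `K'`.

## Source

D. Rolfsen, *Knots and Links*, Publish or Perish (1976), Ch. 5 §A (Seifert surfaces; the genus of a
knot, the minimal genus of a Seifert surface, is a knot invariant — equivalent knots have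
homeomorphic pairs `(S³, K)`, Ch. 1 §A, and the homeomorphism carries Seifert surfaces to Seifert
surfaces of the same genus); in the smooth category used here: A. Juhász, *Differential and
Low-Dimensional Topology*, Cambridge University Press (2023), §4.1, Definition 4.1 (links are
equivalent iff ambient isotopic: an isotopy `Φ` of `M` with `Φ₀ = id`, `Φ₁ ∘ L₀ = L₁` — this is
`Literature.Topology.FourManifolds.IsAmbientIsotopic`), §4.3, Definition 4.8 (Seifert surface) and Definition 4.13 (Seifert genus
`g(K)`); P. Cromwell, *Knots and Links*, Cambridge University Press (2004), Ch. 5, Definition 5.0.1,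
p. 102 (genus of a link as the minimal genus of a connected orientable spanning surface). The
statement is folklore; the printed argument is the one-liner "a homeomorphism (here: the stage-`1`
diffeomorphism of the ambient isotopy) of `S³` taking `K` to `K'` takes Seifert surfaces of `K` to
Seifert surfaces of `K'` of the same genus".

## Proof

`K.IsIsotopic K'` provides an ambient isotopy `F` of `𝕊 3` with `F 1 ∘ K = K'`; its stage-`1` map is
a genuine diffeomorphism `Φ = F.toDiffeomorph 1 : 𝕊 3 ≃ₘ 𝕊 3` (`Literature.Topology.FourManifolds.AmbientIsotopy.toDiffeomorph`),
with `Φ ∘ K = K'` and `Φ⁻¹ ∘ K' = K`. Given a Seifert surface of `K`, i.e. a smooth injective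
immersion `F : S → ℝ⁴` with `‖F‖ = 1` and `F|∂S = K ∘ e`, the new surface map is
`val ∘ Φ ∘ cF : S → ℝ⁴` with `cF : S → 𝕊 3` the corestriction of `F`:

* smoothness: `ContMDiff.codRestrict_sphere` (corestriction to the sphere is smooth),
  `Diffeomorph.contMDiff`, `contMDiff_coe_sphere`;
* immersion: by the chain rule `mfderiv_comp`, `d(val ∘ Φ ∘ cF) = d val ∘ dΦ ∘ d cF`; `d cF` is
  injective because `dF = d val ∘ d cF` is, `dΦ` is a linear isomorphism
  (`Diffeomorph.mfderivToContinuousLinearEquiv`), and `d val` is injective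
  (`mfderiv_coe_sphere_injective`);
* boundary values: `Φ (F x) = Φ (K (e x)) = K' (e x)` on `∂S`;
* the abstract surface `S`, its orientability and `rank H₁(S; ℤ) = 2g` are untouched.

Hence `{g | K.HasSeifertSurfaceOfGenus g} = {g | K'.HasSeifertSurfaceOfGenus g}` and the infima
agree. This file only adds theorems (no definitions, no instances, no notation: the sphere
`𝕊 3 = Metric.sphere (0 : EuclideanSpace ℝ (Fin (3 + 1))) 1` and `𝔼 4 = EuclideanSpace ℝ (Fin 4)`,
abbreviated in `SliceGenus.lean`, are written out in full here).
-/

open scoped Manifold ContDiff Topology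
open Function Set

noncomputable section

namespace Literature.Topology.FourManifolds

-- Mathlib's scoped instance `Fact (finrank ℝ (EuclideanSpace ℝ (Fin n)) = n)`, feeding the
-- `[Fact (finrank ℝ E = n + 1)]` hypotheses of the sphere API (`contMDiff_coe_sphere`, ...)
open scoped EuclideanSpace

namespace Knot

/-- **Transport of Seifert surfaces along a diffeomorphism of `𝕊 3`.** If `Φ : 𝕊 3 ≃ₘ 𝕊 3` is a
diffeomorphism with `Φ ∘ K = K'` and `F : S → 𝕊 3 ⊂ ℝ⁴` is a Seifert surface of genus `g` for
`K`, then `Φ ∘ F` is a Seifert surface of genus `g` for `K'`: it is smooth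
(`ContMDiff.codRestrict_sphere`, `contMDiff_coe_sphere`), injective, an immersion (chain rule
`mfderiv_comp`; `dΦ` is invertible, `Diffeomorph.mfderivToContinuousLinearEquiv`; the inclusion
`𝕊 3 ↪ ℝ⁴` is an immersion, `mfderiv_coe_sphere_injective`), restricts to `K' ∘ e` on `∂S`, and the
abstract surface `S` (orientability, `rank H₁`) is unchanged.
Rolfsen, *Knots and Links* (1976), Ch. 5 §A (the genus, defined via Seifert surfaces, is a knot
invariant: equivalent knots have homeomorphic pairs `(S³, K)`, Ch. 1 §A); in the smooth setting of
this file: Juhász, *Differential and Low-Dimensional Topology* (2023), §4.1, Def. 4.1 (equivalence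
of links = ambient isotopy `Φ₁ ∘ L₀ = L₁`), §4.3, Def. 4.8 (Seifert surface), Def. 4.13 (Seifert
genus); Cromwell, *Knots and Links* (2004), Ch. 5, Definition 5.0.1, p. 102.
[cite: RolfsenKnotsLinks1976, Ch. 5 §A] -/
theorem HasSeifertSurfaceOfGenus.of_diffeomorph {K K' : Knot}
    (Φ : Metric.sphere (0 : EuclideanSpace ℝ (Fin (3 + 1))) 1 ≃ₘ^∞⟮𝓡 3, 𝓡 3⟯
      Metric.sphere (0 : EuclideanSpace ℝ (Fin (3 + 1))) 1)
    (hΦ : ∀ x, Φ (K x) = K' x) {g : ℕ} (h : K.HasSeifertSurfaceOfGenus g) :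
    K'.HasSeifertSurfaceOfGenus g := by
  obtain ⟨S, _, _, _, _, _, _, _, F, e, ⟨hO, hF, hinj, hmf, hbd, hrk⟩, hnorm⟩ := h
  have hmem : ∀ x, F x ∈ Metric.sphere (0 : EuclideanSpace ℝ (Fin (3 + 1))) 1 :=
    fun x ↦ mem_sphere_zero_iff_norm.2 (hnorm x)
  -- the corestriction of `F` to the sphere, a smooth map into the manifold `𝕊 3`
  set cF : S → Metric.sphere (0 : EuclideanSpace ℝ (Fin (3 + 1))) 1 := Set.codRestrict F _ hmem
  have hcF : ContMDiff (𝓡∂ 2) (𝓡 3) ∞ cF := hF.codRestrict_sphere hmem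
  -- the inclusion `𝕊 3 ↪ ℝ⁴` is smooth
  have hval : ContMDiff (𝓡 3) 𝓘(ℝ, EuclideanSpace ℝ (Fin 4)) ∞
      (Subtype.val : Metric.sphere (0 : EuclideanSpace ℝ (Fin (3 + 1))) 1 →
        EuclideanSpace ℝ (Fin 4)) :=
    contMDiff_coe_sphere (n := 3)
  refine ⟨S, inferInstance, inferInstance, inferInstance, inferInstance, inferInstance,
    inferInstance, inferInstance,
    fun x ↦ ((Φ (cF x) : Metric.sphere (0 : EuclideanSpace ℝ (Fin (3 + 1))) 1) :
      EuclideanSpace ℝ (Fin 4)), e,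
    ⟨hO, hval.comp (Φ.contMDiff.comp hcF),
      Subtype.val_injective.comp (Φ.injective.comp (hinj.codRestrict hmem)), fun x ↦ ?_,
      fun x ↦ ?_, hrk⟩, fun x ↦ norm_eq_of_mem_sphere (Φ (cF x))⟩
  · -- immersion: `d(val ∘ Φ ∘ cF) = d val ∘ dΦ ∘ d cF`, a composition of three injections
    have h1 : MDifferentiableAt (𝓡∂ 2) (𝓡 3) cF x := hcF.mdifferentiableAt (by simp)
    have h2 : MDifferentiableAt (𝓡 3) (𝓡 3) Φ (cF x) := Φ.contMDiff.mdifferentiableAt (by simp)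
    have h3 : ∀ v : Metric.sphere (0 : EuclideanSpace ℝ (Fin (3 + 1))) 1,
        MDifferentiableAt (𝓡 3) 𝓘(ℝ, EuclideanSpace ℝ (Fin 4))
          (Subtype.val : Metric.sphere (0 : EuclideanSpace ℝ (Fin (3 + 1))) 1 →
            EuclideanSpace ℝ (Fin 4)) v :=
      fun v ↦ hval.mdifferentiableAt (by simp)
    -- `d cF` is injective because `dF = d val ∘ d cF` is (`F = val ∘ cF` definitionally)
    have hcFinj : Injective (mfderiv (𝓡∂ 2) (𝓡 3) cF x) := by
      have key : mfderiv (𝓡∂ 2) 𝓘(ℝ, EuclideanSpace ℝ (Fin 4)) F x =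
          (mfderiv (𝓡 3) 𝓘(ℝ, EuclideanSpace ℝ (Fin 4))
              (Subtype.val : Metric.sphere (0 : EuclideanSpace ℝ (Fin (3 + 1))) 1 →
                EuclideanSpace ℝ (Fin 4)) (cF x)).comp
            (mfderiv (𝓡∂ 2) (𝓡 3) cF x) :=
        mfderiv_comp x (h3 _) h1
      have hFx : Injective
          (⇑(mfderiv (𝓡 3) 𝓘(ℝ, EuclideanSpace ℝ (Fin 4))
              (Subtype.val : Metric.sphere (0 : EuclideanSpace ℝ (Fin (3 + 1))) 1 →
                EuclideanSpace ℝ (Fin 4)) (cF x)) ∘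
            ⇑(mfderiv (𝓡∂ 2) (𝓡 3) cF x)) := by
        have := hmf x
        rwa [key] at this
      exact hFx.of_comp
    -- `dΦ` is a linear isomorphism
    have hΦinj : Injective (mfderiv (𝓡 3) (𝓡 3) Φ (cF x)) := by
      rw [← Φ.mfderivToContinuousLinearEquiv_coe (by simp)]
      exact (Φ.mfderivToContinuousLinearEquiv (by simp) (cF x)).injective
    show Injective (mfderiv (𝓡∂ 2) 𝓘(ℝ, EuclideanSpace ℝ (Fin 4))
      ((Subtype.val : Metric.sphere (0 : EuclideanSpace ℝ (Fin (3 + 1))) 1 →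
        EuclideanSpace ℝ (Fin 4)) ∘ (⇑Φ ∘ cF)) x)
    rw [mfderiv_comp x (h3 _) (h2.comp x h1), mfderiv_comp x h2 h1]
    exact ((mfderiv_coe_sphere_injective _).comp (hΦinj.comp hcFinj) :)
  · -- boundary condition: `Φ (F x) = Φ (K (e x)) = K' (e x)` on `∂S`
    show ((Φ (cF x) : Metric.sphere (0 : EuclideanSpace ℝ (Fin (3 + 1))) 1) :
        EuclideanSpace ℝ (Fin 4)) =
      ((K' (e x) : Metric.sphere (0 : EuclideanSpace ℝ (Fin (3 + 1))) 1) : EuclideanSpace ℝ (Fin 4))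
    rw [← hΦ, show cF x = K (e x) from Subtype.ext (hbd x)]

/-- **Discharge** of `IsIsotopic.genus_eq`: **the Seifert genus is an isotopy invariant.** If
`K' = F 1 ∘ K` for an ambient isotopy `F` of `𝕊 3`, the stage-`1` diffeomorphism
`Φ = F.toDiffeomorph 1` carries Seifert surfaces of `K` of genus `g` to Seifert surfaces of `K'`
of genus `g` and `Φ⁻¹` carries them back (`HasSeifertSurfaceOfGenus.of_diffeomorph`), so the two
sets of genera agree and so do their minima.
Rolfsen, *Knots and Links* (1976), Ch. 5 §A (genus of a knot via Seifert surfaces; a knot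
invariant since equivalent knots have homeomorphic — here diffeomorphic, by the ambient isotopy —
pairs `(S³, K)`, Ch. 1 §A); Juhász, *Differential and Low-Dimensional Topology* (2023), §4.1,
Def. 4.1 (knots are equivalent iff ambient isotopic, `Φ₀ = id`, `Φ₁ ∘ L₀ = L₁`) and §4.3, Def. 4.13
(the Seifert genus `g(K)`, an invariant of the knot so defined); Cromwell, *Knots and Links* (2004),
Ch. 5, Definition 5.0.1, p. 102. [cite: RolfsenKnotsLinks1976, Ch. 5 §A] -/
theorem IsIsotopic.genus_eq_holds : IsIsotopic.genus_eq := by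
  intro K K' h
  obtain ⟨F, hF⟩ := h
  have hΦ : ∀ x, F.toDiffeomorph 1 (K x) = K' x := fun x ↦ congrFun hF x
  have hΦ' : ∀ x, (F.toDiffeomorph 1).symm (K' x) = K x := fun x ↦ by
    rw [← hΦ, Diffeomorph.symm_apply_apply]
  unfold genus
  congr 1
  ext g
  exact ⟨HasSeifertSurfaceOfGenus.of_diffeomorph _ hΦ,
    HasSeifertSurfaceOfGenus.of_diffeomorph _ hΦ'⟩

end Knot

end Literature.Topology.FourManifolds
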